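import Mathlib
import HarnessLib
import Summits.CriticalPhenomena.PercolationContinuityZ3.Theses.PercTreeValue
import Summits.CriticalPhenomena.PercolationContinuityZ3.Theorems.PercTreeValueTetrahedronDisjointCoexistenceStubConfineProduct
import Summits.CriticalPhenomena.PercolationContinuityZ3.Theorems.PercTreeValueTetrahedronDisjointCoexistenceStubPairSymm
import Summits.CriticalPhenomena.PercolationContinuityZ3.Theorems.PercTreeValueTetrahedronDisjointCoexistenceStubTwoReplica
import Summits.CriticalPhenomena.PercolationContinuityZ3.Theorems.PercTreeValueAssemblyViaDisjointCoexistence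
import Literature.Probability.Percolation.TwoPointFunction

/-!
# Route PercTreeValue — transfers for the crux `TetrahedronDisjointCoexistence` (stmt-CriticalPhenomena-7798)

Line `SketchIdeator2` (cards `confinement-squaring`, `bridge-seam-switching`; lead
prover-line-stmt-CriticalPhenomena-7798-0). The crux is reverse-BK up to a constant for the two opposite
edges `{0, a_r}`, `{b_r, c_r}` of the lattice tetrahedron `T_r` (`a_r = (r,r,0)`, `b_r = (r,0,r)`,
`c_r = (0,r,r)`) at `p_c(ℤ³)`:
`∃ δ > 0, ∃ r₀, ∀ r ≥ r₀, δ τ(0,a_r) τ(b_r,c_r) ≤ P(0 ↔ a_r, b_r ↔ c_r, 0 ↮ b_r)`.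

This file assembles the LANDED stubs of the line into the two sorry-free TRANSFER THEOREMS (the crux from a
one-law statement), and records that each transfer hypothesis is continuity-strength:

* `stub_cruxOfConfinement` — CONFINEMENT SQUARING: if the critical cluster
  of `0`, conditioned on containing `a_r`, lies in the half-space `H_r = {x | 2x₂ + 2 ≤ r}` with probability
  `≥ c` (uniformly in `r ≥ r₀`), then the crux holds with `δ = c²`. Ingredients: `stub_confineProduct`
  (independence of whole-cluster confinement events with disjoint LATTICE-edge supports + inclusion in the
  disjoint-coexistence event), `stub_pairSymm` (the rotoreflection `φ_r(x) = (r − x₁, x₀, r − x₂)` of `T_r`: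
  `τ(b_r,c_r) = τ(0,a_r)` and `P(Conf(U_r; b_r,c_r)) = P(Conf(H_r; 0,a_r))`, `U_r = {x | r + 2 ≤ 2x₂}`), and
  `lower_upper_edges_disjoint` (the lattice-edge supports of `H_r`, `U_r` are disjoint).
* `stub_cruxOfTwoReplica` — CLUSTER GAS: if two INDEPENDENT critical
  configurations have `a_r ∈ C₁(0)`, `c_r ∈ C₂(b_r)`, `C₂(b_r)` finite and `C₁(0) ∩ C₂(b_r) = ∅` with
  probability `≥ q τ(0,a_r) τ(b_r,c_r)`, then the crux holds with `δ = q` (`stub_twoReplica`).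
* (companion file `…TransferB.lean`: `tetrahedronDisjointCoexistence_of_restriction_of_blocking` — restriction squaring +
  interface blocking, the route's foreseen two-layer split, `δ = c₂ c₁²`.)
* `percolationContinuityZ3_of_confinementPositivity`, `percolationContinuityZ3_of_twoReplicaNonIntersection`:
  composed with the landed `AssemblyViaDisjointCoexistence_proof` (crux → `θ(p_c) = 0`), either hypothesis
  settles the conjunct — i.e. both transfers are crux-sized (they fail in every jump world), as the cards say.

No new definitions; the hypotheses are spelled out over tree declarations exactly as the registered stubs
`stub_confinementPositivity` (open) and the two-replica event of `stub_twoReplica`.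
-/

noncomputable section

namespace Summit.CriticalPhenomena.PercolationContinuityZ3.Theorems.TetrahedronDisjointCoexistence

open MeasureTheory
open Literature.Probability.Percolation Literature.Probability.LatticeModels

/-- The lattice-edge supports of `H_r = {2x₂ + 2 ≤ r}` and `U_r = {r + 2 ≤ 2x₂}` are disjoint: an edge of `ℤ³`
touching both would join two vertices whose heights differ by at least `2`. -/
theorem lower_upper_edges_disjoint (r : ℕ) :
    Disjoint (edgesTouching {x : Site 3 | 2 * x 2 + 2 ≤ (r : ℤ)} ∩ (zdGraph 3).edgeSet)
      (edgesTouching {x : Site 3 | (r : ℤ) + 2 ≤ 2 * x 2} ∩ (zdGraph 3).edgeSet) := by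
  rw [Set.disjoint_left]
  rintro e ⟨⟨v, hve, hv⟩, he⟩ ⟨⟨w, hwe, hw⟩, -⟩
  simp only [Set.mem_setOf_eq] at hv hw
  induction e using Sym2.ind with
  | h x y =>
    rw [SimpleGraph.mem_edgeSet] at he
    have hxy : y 2 - x 2 ≤ 1 ∧ x 2 - y 2 ≤ 1 := by
      obtain ⟨j, h | h⟩ := (zdGraph_adj_iff x y).1 he
      · rw [h]
        by_cases hj : (2 : Fin 3) = j
        · subst hj; simp
        · simp [hj]
      · rw [h]
        by_cases hj : (2 : Fin 3) = j
        · subst hj; simp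
        · simp [hj]
    rw [Sym2.mem_iff] at hve hwe
    rcases hve with rfl | rfl <;> rcases hwe with rfl | rfl <;> omega

/-- **Confinement squaring** (transfer theorem of line `SketchIdeator2`): CONFINEMENT POSITIVITY of the critical
cluster of `0` conditioned on `0 ↔ a_r` — `P(a_r ∈ C(0) ⊆ {x | 2x₂ + 2 ≤ r}) ≥ c · τ(0, a_r)` for `r ≥ r₀` — implies
the crux `TetrahedronDisjointCoexistence` with `δ = c²`: for `r ≥ max r₀ 1`,
`c² τ(0,a_r) τ(b_r,c_r) = (c τ(0,a_r))² ≤ P(Conf(H_r;0,a_r))² = P(Conf(H_r;0,a_r)) P(Conf(U_r;b_r,c_r)) ≤ D_r`. -/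
theorem stub_cruxOfConfinement
    (hConf : ∃ c : ℝ, 0 < c ∧ ∃ r₀ : ℕ, ∀ r : ℕ, r₀ ≤ r →
      c * tau 3 (criticalProbI 3) 0 ![(r : ℤ), (r : ℤ), 0] ≤
        (bondPercolation (zdGraph 3) (criticalProbI 3)).real
          {ω | (![(r : ℤ), (r : ℤ), 0] : Site 3) ∈ openCluster ω 0 ∧
            openCluster ω 0 ⊆ {x | 2 * x 2 + 2 ≤ (r : ℤ)}}) :
    Theses.PercTreeValue.TetrahedronDisjointCoexistence := by
  unfold Theses.PercTreeValue.TetrahedronDisjointCoexistence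
  obtain ⟨c, hc, r₀, h⟩ := hConf
  refine ⟨c ^ 2, by positivity, max r₀ 1, fun r hr => ?_⟩
  have hr₀ : r₀ ≤ r := le_trans (le_max_left _ _) hr
  have hr1 : 1 ≤ r := le_trans (le_max_right _ _) hr
  obtain ⟨hτ, hconf⟩ := stub_pairSymm (criticalProbI 3) r
  have h1 := h r hr₀
  have hb : (0 : Site 3) ≠ ![(r : ℤ), 0, (r : ℤ)] := by
    intro h0
    have h00 := congr_fun h0 0
    simp at h00
    omega
  have hprod := stub_confineProduct (criticalProbI 3) {x : Site 3 | 2 * x 2 + 2 ≤ (r : ℤ)}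
    {x : Site 3 | (r : ℤ) + 2 ≤ 2 * x 2} 0 ![(r : ℤ), (r : ℤ), 0] ![(r : ℤ), 0, (r : ℤ)]
    ![0, (r : ℤ), (r : ℤ)] hb (lower_upper_edges_disjoint r)
  rw [hconf] at hprod
  have hτ' : tau 3 (criticalProbI 3) ![(r : ℤ), 0, (r : ℤ)] ![0, (r : ℤ), (r : ℤ)] =
      tau 3 (criticalProbI 3) 0 ![(r : ℤ), (r : ℤ), 0] := by
    rw [tau_def, tau_def]; exact hτ
  rw [hτ']
  have hτnn : 0 ≤ tau 3 (criticalProbI 3) 0 ![(r : ℤ), (r : ℤ), 0] := tau_nonneg _ _ _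
  calc c ^ 2 * tau 3 (criticalProbI 3) 0 ![(r : ℤ), (r : ℤ), 0] *
        tau 3 (criticalProbI 3) 0 ![(r : ℤ), (r : ℤ), 0]
      = (c * tau 3 (criticalProbI 3) 0 ![(r : ℤ), (r : ℤ), 0]) *
          (c * tau 3 (criticalProbI 3) 0 ![(r : ℤ), (r : ℤ), 0]) := by ring
    _ ≤ (bondPercolation (zdGraph 3) (criticalProbI 3)).real
            {ω | (![(r : ℤ), (r : ℤ), 0] : Site 3) ∈ openCluster ω 0 ∧
              openCluster ω 0 ⊆ {x | 2 * x 2 + 2 ≤ (r : ℤ)}} *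
          (bondPercolation (zdGraph 3) (criticalProbI 3)).real
            {ω | (![(r : ℤ), (r : ℤ), 0] : Site 3) ∈ openCluster ω 0 ∧
              openCluster ω 0 ⊆ {x | 2 * x 2 + 2 ≤ (r : ℤ)}} :=
        mul_le_mul h1 h1 (by positivity) measureReal_nonneg
    _ ≤ _ := hprod

/-- **Cluster-gas transfer** (line `SketchIdeator2`, form (G)): TWO-REPLICA NON-INTERSECTION — two independent
critical configurations realise `a_r ∈ C₁(0)`, `c_r ∈ C₂(b_r)` with `C₂(b_r)` finite and `C₁(0) ∩ C₂(b_r) = ∅`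
with probability `≥ q τ(0,a_r) τ(b_r,c_r)` — implies the crux with `δ = q` (`stub_twoReplica`). -/
theorem stub_cruxOfTwoReplica
    (hQ : ∃ q : ℝ, 0 < q ∧ ∃ r₀ : ℕ, ∀ r : ℕ, r₀ ≤ r →
      q * tau 3 (criticalProbI 3) 0 ![(r : ℤ), (r : ℤ), 0] *
          tau 3 (criticalProbI 3) ![(r : ℤ), 0, (r : ℤ)] ![0, (r : ℤ), (r : ℤ)] ≤
        ((bondPercolation (zdGraph 3) (criticalProbI 3)).prod
            (bondPercolation (zdGraph 3) (criticalProbI 3))).real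
          {q : BondConfig (Site 3) × BondConfig (Site 3) |
            (![(r : ℤ), (r : ℤ), 0] : Site 3) ∈ openCluster q.1 0 ∧
              (![0, (r : ℤ), (r : ℤ)] : Site 3) ∈ openCluster q.2 ![(r : ℤ), 0, (r : ℤ)] ∧
              (openCluster q.2 (![(r : ℤ), 0, (r : ℤ)] : Site 3)).Finite ∧
              Disjoint (openCluster q.1 (0 : Site 3)) (openCluster q.2 ![(r : ℤ), 0, (r : ℤ)])}) :
    Theses.PercTreeValue.TetrahedronDisjointCoexistence := by
  unfold Theses.PercTreeValue.TetrahedronDisjointCoexistence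
  obtain ⟨q, hq, r₀, h⟩ := hQ
  refine ⟨q, hq, r₀, fun r hr => (h r hr).trans ?_⟩
  exact stub_twoReplica (zdGraph 3) (criticalProbI 3) (0 : Site 3) ![(r : ℤ), (r : ℤ), 0]
    ![(r : ℤ), 0, (r : ℤ)] ![0, (r : ℤ), (r : ℤ)]

/-- Confinement positivity settles the conjunct `θ(p_c(ℤ³)) = 0` (through the crux and the landed
`AssemblyViaDisjointCoexistence_proof`); in particular it fails in every jump world, as a transfer for this
crux must. -/
theorem percolationContinuityZ3_of_confinementPositivity
    (hConf : ∃ c : ℝ, 0 < c ∧ ∃ r₀ : ℕ, ∀ r : ℕ, r₀ ≤ r →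
      c * tau 3 (criticalProbI 3) 0 ![(r : ℤ), (r : ℤ), 0] ≤
        (bondPercolation (zdGraph 3) (criticalProbI 3)).real
          {ω | (![(r : ℤ), (r : ℤ), 0] : Site 3) ∈ openCluster ω 0 ∧
            openCluster ω 0 ⊆ {x | 2 * x 2 + 2 ≤ (r : ℤ)}}) :
    _root_.PercolationContinuityZ3 := by
  have hA := AssemblyViaDisjointCoexistence_proof
  unfold Theses.PercTreeValue.AssemblyViaDisjointCoexistence at hA
  exact hA (stub_cruxOfConfinement hConf)

/-- Two-replica non-intersection settles the conjunct `θ(p_c(ℤ³)) = 0` likewise. -/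
theorem percolationContinuityZ3_of_twoReplicaNonIntersection
    (hQ : ∃ q : ℝ, 0 < q ∧ ∃ r₀ : ℕ, ∀ r : ℕ, r₀ ≤ r →
      q * tau 3 (criticalProbI 3) 0 ![(r : ℤ), (r : ℤ), 0] *
          tau 3 (criticalProbI 3) ![(r : ℤ), 0, (r : ℤ)] ![0, (r : ℤ), (r : ℤ)] ≤
        ((bondPercolation (zdGraph 3) (criticalProbI 3)).prod
            (bondPercolation (zdGraph 3) (criticalProbI 3))).real
          {q : BondConfig (Site 3) × BondConfig (Site 3) |
            (![(r : ℤ), (r : ℤ), 0] : Site 3) ∈ openCluster q.1 0 ∧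
              (![0, (r : ℤ), (r : ℤ)] : Site 3) ∈ openCluster q.2 ![(r : ℤ), 0, (r : ℤ)] ∧
              (openCluster q.2 (![(r : ℤ), 0, (r : ℤ)] : Site 3)).Finite ∧
              Disjoint (openCluster q.1 (0 : Site 3)) (openCluster q.2 ![(r : ℤ), 0, (r : ℤ)])}) :
    _root_.PercolationContinuityZ3 := by
  have hA := AssemblyViaDisjointCoexistence_proof
  unfold Theses.PercTreeValue.AssemblyViaDisjointCoexistence at hA
  exact hA (stub_cruxOfTwoReplica hQ)


end Summit.CriticalPhenomena.PercolationContinuityZ3.Theorems.TetrahedronDisjointCoexistence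

end
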